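import Summits.QuantumFields.YangMills.Theses.CheckerboardTriality
import HarnessLib

/-!
# Route `CheckerboardTriality`: the glue item `SexticClosureOfSigma3` (stmt-QuantumFields-23400)

`Sigma3Limit → Sigma3DenseUpgrade → SexticClosure` (LINE g10-A «sigma3-twin» of planner ym-idea-1 g10,
restrict-then-tighten on the crux `SexticClosure`):

* `Sigma3Limit` (crux stmt-QuantumFields-23398, OPEN) gives, at every off-diagonal limit point `S₁` along a
  subsequence of an admissible leg scheme, the invariance of `S₁ n` on King's class `KingClass n r₀` under every linear
  isometry with the Σ3 coincidence coordinates;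
* `Sigma3DenseUpgrade` (support stmt-QuantumFields-23399) upgrades, for every one-field family with `OffDiagDensity`,
  the `D₄`-preserving invariance plus the Σ3 invariance on King's class to invariance under `planeRot 0 θ` for every
  Pythagorean angle `θ`;
* at a limit point, `OffDiagDensity S₁` is the second clause of `OffDiagLimitAlong r sch φ S₁`.

Width seat ym-line-sfw-p2-w4 g17 (cell ym-idea-1, free hands) for planner-of-record ym-idea-1 g10.  The crux
`Sigma3Limit` remains OPEN; no summit, leg, crux or rung statement is proved here (R2d is a RECORD rung; the YM mass
gap is NOT proved by any of this).
-/

set_option autoImplicit false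

namespace Summit.QuantumFields.YangMills.Theorems

open Summit.QuantumFields.YangMills.Theses.CheckerboardTriality (Sigma3Limit Sigma3DenseUpgrade SexticClosure)

/-- **Glue of LINE «sigma3-twin»**: the Σ3 twin invariance of the UV limit points (`Sigma3Limit`) and the density
upgrade (`Sigma3DenseUpgrade`) give `SexticClosure` — at a limit point `S₁` feed `OffDiagDensity S₁`
(clause 2 of `OffDiagLimitAlong`), the `D₄`-preserving hypothesis of `SexticClosure` and the Σ3 invariance at the same
data into the upgrade. [folklore] -/
theorem checkerboardTriality_sexticClosure_of_sigma3 (hS3 : Sigma3Limit) (hD : Sigma3DenseUpgrade) :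
    SexticClosure := by
  unfold Summit.QuantumFields.YangMills.Theses.CheckerboardTriality.SexticClosure
  unfold Summit.QuantumFields.YangMills.Theses.CheckerboardTriality.Sigma3Limit at hS3
  unfold Summit.QuantumFields.YangMills.Theses.CheckerboardTriality.Sigma3DenseUpgrade at hD
  intro G _ _ _ _ hG
  letI : MeasurableSpace G := borel G
  haveI : BorelSpace G := ⟨rfl⟩
  intro r a ha ha0 hMB sch hsch r₀ hr₀ φ hφ S₁ hS₁ hD4 n hn F hF θ hθ
  exact hD.2 S₁ hS₁.2.1 n hn r₀ hr₀ (hD4 n hn)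
    (fun F' hF' R hR => hS3 G hG r a ha ha0 hMB sch hsch r₀ hr₀ φ hφ S₁ hS₁ n hn F' hF' R hR) F hF θ hθ

/-- **Item stmt-QuantumFields-23400 `CheckerboardTriality.SexticClosureOfSigma3` holds**:
`Sigma3Limit → Sigma3DenseUpgrade → SexticClosure`. [folklore] -/
theorem checkerboardTriality_sexticClosureOfSigma3_proof :
    Summit.QuantumFields.YangMills.Theses.CheckerboardTriality.SexticClosureOfSigma3 :=
  fun hS3 hD => checkerboardTriality_sexticClosure_of_sigma3 hS3 hD

end Summit.QuantumFields.YangMills.Theorems
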